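import Summits.QuantumFields.YangMills.Theorems.UnitScaleTiltFluctuationComparisonRegPrGlobalSlackKernelMatchingOn
import HarnessLib

/-!
# `UnitScaleTiltFluctuationComparisonRegPrGlobalSlackLocalToGlobalOn` — LOCAL ⇒ GLOBAL WITH KING'S SLACK, READ ON A SUB-PREDICATE `S` OF THE WINDOW
# (crux `FluctuationComparisonRegPrIntL`, stmt-QuantumFields-20520, STUB (i)* `stub_smallBlocksSlackOnChiAll`, odd `L < 7`; width-lever lane B «(R1) print's χ of
# [Balaban1985UV3] (47) back», seat ym-ust-19935-r1 g2; companion of `…GlobalSlackKernelMatchingOn`)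

The producer half of the K1a chain with a window sub-predicate `S K n h V` threaded (see the companion file for WHY): the per-polymer two-cut-off row with King's slack
asked only at doubly-`S`-good data (`PolymerCauchyMinAtWSlackOn S`), together with the five FULL-window producer rows `PintDecompTrivT` ((43)), `LocCover`/`LocBlockVolume`/
`LocMatched` ((45)–(46), (24)) and `TermSizeTrivT` ((44), run `K+1`'s unmatched finest slice) — all theorems for the canonical polymerisation (`…GlobalSlackCanonicalPolymers*`) —
give the GLOBAL slack row asked only at doubly-`S`-good data (`GlobalSupRateWSlackOn S`) with the SAME `K`-uniform constant `max(C′,0)·(C_T + C/(1 − L^{a−1}) + C/(1 − L⁻¹))`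
as the full-window producer `GlobalSlackLocalToGlobal.globalSupRateWSlack_of_polymerWSlack` (p530498).  CREDIT: the proof of §1 is ym-cruxidea-19201-1 g11's counting
(ported by ym3-torus-p2 g14) VERBATIM at a doubly-`S`-good datum — two hypotheses `S K n h V`, `S (K+1) n _ V` are introduced and handed to the local row, nothing else changes.
§2 composes with the companion's `polymerCauchyMinAtTSlackOn_of_charts`: the six chart rows (three ON `S`) ⟹ `GlobalSupRateWSlackOn S D b₀ p₀ (θ²) a 7 C₀` with the explicit
constant — at `S :=` print's χ this is the registered (i)* currency `PrintChi.GlobalSupRateTSlackOn` (sibling file `…GlobalSlackCanonicalOnChi`).  Pure counting; every row is a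
hypothesis schema; nothing of [Balaban1985UV3]/[King1986] is asserted.

References: C. King, CMP 102 (1986) 649–677 [King1986] (Thm 3.4 (3.9) p.656, (3.12)–(3.13) p.657, Prop. 3.6 p.662); T. Bałaban, CMP 102 (1985) 255–275 [Balaban1985UV3]
((43)–(46) pp.266–267, (47) p.267, (57) p.270).
-/

set_option autoImplicit false

noncomputable section

open scoped BigOperators
open Literature.MathematicalPhysics.QuantumFieldTheory.Balaban1983to89
open Literature.MathematicalPhysics.QuantumFieldTheory.Balaban1983to89.T3ContinuumYM3Torus
open Literature.MathematicalPhysics.QuantumFieldTheory.Balaban1983to89.T3UnitScaleTilt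
open Literature.MathematicalPhysics.QuantumFieldTheory.Balaban1983to89.T3LevelShift
open Literature.MathematicalPhysics.QuantumFieldTheory.Balaban1983to89.T3AlphaInputsAC
open Literature.MathematicalPhysics.QuantumFieldTheory.Balaban1983to89.T3AlphaPolymerSocket
open Literature.MathematicalPhysics.QuantumFieldTheory.Balaban1983to89.T3AlphaInputsACTwoRun
open Literature.MathematicalPhysics.QuantumFieldTheory.Balaban1983to89.T3AlphaInputsACTwoRunLevel
open Literature.MathematicalPhysics.QuantumFieldTheory.Balaban1983to89.T3Thresholds
open Summit.QuantumFields.YangMills.Theorems.LogComparisonPolymerBudget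
  (card_site_zero sum_exp_le inv_pow_pow_eq_rpow inv_pow_rpow_eq_rpow extra_budget_le)
open Summit.QuantumFields.YangMills.Theorems.LogComparisonLevelCauchyMinT (levelDataT PintH_eq_sum_levelDataT)
open Summit.QuantumFields.YangMills.Theorems.GlobalSlackKernelMatching
open Summit.QuantumFields.YangMills.Theorems.GlobalSlackLocalToGlobal
  (GlobalSupRateWSlack PolymerCauchyMinAtWSlack level_budget_geom_le eight_pow_eq_card_mul sum_reflect_geom_le levelDataT_succ_sub)
open Summit.QuantumFields.YangMills.Theorems.GlobalSlackKernelMatchingOn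

namespace Summit.QuantumFields.YangMills.Theorems.GlobalSlackLocalToGlobalOn

/-! ## §1 LOCAL ON `S` ⇒ GLOBAL ON `S` (ideator 1 g11 / ym3-torus-p2 g14's counting, `S` threaded) -/

section LocalToGlobal

variable {F : T3Family} {γ : ℝ}

/-- **THE GLOBAL SLACK ROW ON `S` FROM THE PER-POLYMER SLACK ROW ON `S`, GENERIC RATE WEIGHT** (pure counting): for `0 < γ ≤ 1`, `0 < b₀`, a weight `w n ≥ 0` dominating
`θ(n+1)²`, `0 < a < 1`, `0 ≤ C`, `0 ≤ C_T`: the (43)-decomposition over a term function, summable ∕ block-volume ∕ matched localisation domains at the row's decay rate, the printed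
size (44) of the terms (FULL window — a theorem for the canonical polymerisation) and the per-polymer two-cut-off row with King's slack ON `S` give the GLOBAL row ON `S` with the
SAME `K`-uniform constant `max(C′,0)·(C_T + C/(1 − L^{a−1}) + C/(1 − L⁻¹))` as the full-window producer `globalSupRateWSlack_of_polymerWSlack` (whose proof this is, at a
doubly-`S`-good datum). [cite: King1986, Thm 3.4 (3.9) p.656 and (3.12)-(3.13) p.657; Balaban1985UV3, (43)-(46) pp.266-267, (47) p.267] -/
theorem globalSupRateWSlackOn_of_polymerWSlackOn (S : WinPred F) {D : AlphaDataT3 F γ} {PT : TermFn F} {b₀ p₀ κ₁ a C C_T C' : ℝ} {σ : ℕ} {w : ℕ → ℝ}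
    (hγ : 0 < γ) (hγ1 : γ ≤ 1) (hb : 0 < b₀) (hw0 : ∀ n, 0 ≤ w n) (hw : ∀ n, θBal F.L γ b₀ p₀ (n + 1) ^ 2 ≤ w n)
    (ha : 0 < a) (ha1 : a < 1) (hC : 0 ≤ C) (hCT : 0 ≤ C_T)
    (hdec : PintDecompTrivT D PT) (hLC : LocCover D κ₁ C') (hBV : LocBlockVolume D) (hLM : LocMatched D)
    (hTS : TermSizeTrivT D PT b₀ p₀ C_T κ₁) (hPC : PolymerCauchyMinAtWSlackOn S D PT b₀ p₀ κ₁ w a σ C) :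
    GlobalSupRateWSlackOn S D b₀ p₀ w a σ
      (max C' 0 * (C_T + C / (1 - (F.L : ℝ) ^ (a - 1)) + C / (1 - (F.L : ℝ)⁻¹))) := by
  classical
  obtain ⟨c, hc⟩ := hPC
  obtain ⟨_, hts⟩ := hTS
  have hLn : 1 ≤ F.L := F.hL.2.le
  have hL : (1 : ℝ) < (F.L : ℝ) := by exact_mod_cast F.hL.2
  have hL0 : (0 : ℝ) < (F.L : ℝ) := by linarith
  -- the two geometric ratios
  set ra : ℝ := (F.L : ℝ) ^ (a - 1) with hra_def
  set r0 : ℝ := (F.L : ℝ)⁻¹ with hr0_def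
  have hra0 : 0 ≤ ra := (Real.rpow_pos_of_pos hL0 _).le
  have hra1 : ra < 1 := Real.rpow_lt_one_of_one_lt_of_neg hL (by linarith)
  have hr00 : 0 ≤ r0 := (inv_pos.mpr hL0).le
  have hr01 : r0 < 1 := inv_lt_one_of_one_lt₀ hL
  have hθ : ∀ i, 0 ≤ θBal F.L γ b₀ p₀ i := fun i => (T3MinimiserStabilityReduction.θBal_pos hLn hγ hγ1 hb p₀ i).le
  have hC' : 0 ≤ max C' 0 := le_max_right _ _
  have hTa : 0 ≤ C / (1 - ra) := div_nonneg hC (by linarith)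
  have hT0 : 0 ≤ C / (1 - r0) := div_nonneg hC (by linarith)
  refine ⟨fun K n => ∑ j ∈ Finset.range (K - n), ∑ Y ∈ D.Loc K (K - n) (D.triv K (K - n)) (1 + j), c K n j Y, ?_⟩
  intro K n hn V hV hV₁ hV₂
  have hle : n ≤ K + 1 := hn.trans (Nat.le_succ K)
  set θ := θBal F.L γ b₀ p₀ n with hθ_def
  set N : ℝ := (Fintype.card (Site (F.P n) 0) : ℝ) with hN_def
  have hN0 : 0 ≤ N := by positivity
  set La : ℝ := (((F.L : ℝ) ^ (K - n))⁻¹) ^ a with hLa_def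
  have hLa0 : 0 ≤ La := by positivity
  have hθn : 0 ≤ θ := hθ n
  have hθσ : 0 ≤ θ ^ σ := pow_nonneg hθn σ
  have hwn : 0 ≤ w n := hw0 n
  -- (1) the two height readings, decomposed by steps
  have hK1 : K + 1 - n = (K - n) + 1 := by omega
  have hP1 : D.PintH (K + 1) n V =
      (∑ j ∈ Finset.range (K - n), levelDataT D PT (K + 1) (j + 1) n V) + levelDataT D PT (K + 1) 0 n V := by
    rw [PintH_eq_sum_levelDataT D PT hdec, hK1, Finset.sum_range_succ']
  have hP0 : D.PintH K n V = ∑ j ∈ Finset.range (K - n), levelDataT D PT K j n V := PintH_eq_sum_levelDataT D PT hdec K n V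
  have hdiff : D.PintH (K + 1) n V - D.PintH K n V -
        ∑ j ∈ Finset.range (K - n), ∑ Y ∈ D.Loc K (K - n) (D.triv K (K - n)) (1 + j), c K n j Y =
      levelDataT D PT (K + 1) 0 n V +
        ∑ j ∈ Finset.range (K - n), (levelDataT D PT (K + 1) (j + 1) n V - levelDataT D PT K j n V -
          ∑ Y ∈ D.Loc K (K - n) (D.triv K (K - n)) (1 + j), c K n j Y) := by
    rw [hP1, hP0, Finset.sum_sub_distrib, Finset.sum_sub_distrib]
    ring
  rw [hdiff]
  -- (2) the unmatched finest slice of run `K+1` (size IS a rate): (44) at run K+1, level 1; (45)-(46); then θ(n+1)² ≤ w n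
  have hKn : K + 1 - n - 1 = K - n := by omega
  have hextra : |levelDataT D PT (K + 1) 0 n V| ≤ max C' 0 * C_T * N * (w n * La) := by
    have hld : levelDataT D PT (K + 1) 0 n V = ∑ Y ∈ D.Loc (K + 1) (K + 1 - n) (D.triv (K + 1) (K + 1 - n)) 1,
        PT (K + 1) (K + 1 - n) 1 Y
          (fieldShift (F.sitesPerDir_eq (m := F.m) (K := K + 1) (j := K + 1 - n) (m' := F.m) (K' := n) (j' := 0) (by omega)) V) := by
      simp only [levelDataT, dif_pos hle, Nat.add_zero]
    rw [hld]
    have h1 : ∀ Y ∈ D.Loc (K + 1) (K + 1 - n) (D.triv (K + 1) (K + 1 - n)) 1,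
        |PT (K + 1) (K + 1 - n) 1 Y
            (fieldShift (F.sitesPerDir_eq (m := F.m) (K := K + 1) (j := K + 1 - n) (m' := F.m) (K' := n) (j' := 0) (by omega)) V)| ≤
          C_T * Real.exp (-κ₁ * D.treeLen (K + 1) 1 Y) * θBal F.L γ b₀ p₀ (n + 1) ^ 2 * (((F.L : ℝ) ^ (K - n))⁻¹) ^ 4 := by
      intro Y hY
      have h := hts (K + 1) n hle V hV 1 le_rfl (by omega) Y hY
      rw [hKn] at h
      exact h
    refine (Finset.abs_sum_le_sum_abs _ _).trans ((Finset.sum_le_sum h1).trans ?_)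
    refine (extra_budget_le D hLC hBV hCT ha1.le hn (D.triv (K + 1) (K + 1 - n))).trans ?_
    rw [show 8 * C_T * max C' 0 * θBal F.L γ b₀ p₀ (n + 1) ^ 2 * (F.L : ℝ) ^ (3 * F.m) * (F.L : ℝ) ^ ((3 * n - a * (K - n : ℕ) : ℝ)) =
        C_T * max C' 0 * θBal F.L γ b₀ p₀ (n + 1) ^ 2 * (8 * (F.L : ℝ) ^ (3 * F.m) * (F.L : ℝ) ^ ((3 * n - a * (K - n : ℕ) : ℝ))) by ring,
      eight_pow_eq_card_mul F a K n]
    have hNL : 0 ≤ C_T * max C' 0 * (N * La) := by positivity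
    calc C_T * max C' 0 * θBal F.L γ b₀ p₀ (n + 1) ^ 2 * ((Fintype.card (Site (F.P n) 0) : ℝ) * (((F.L : ℝ) ^ (K - n))⁻¹) ^ a)
        = (C_T * max C' 0 * (N * La)) * θBal F.L γ b₀ p₀ (n + 1) ^ 2 := by ring
      _ ≤ (C_T * max C' 0 * (N * La)) * w n := mul_le_mul_of_nonneg_left (hw n) hNL
      _ = max C' 0 * C_T * N * (w n * La) := by ring
  -- (3) one matched level: the per-polymer slack row ON `S` summed over the level's domains, margin kept
  have hlevel : ∀ j ∈ Finset.range (K - n),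
      |levelDataT D PT (K + 1) (j + 1) n V - levelDataT D PT K j n V -
          ∑ Y ∈ D.Loc K (K - n) (D.triv K (K - n)) (1 + j), c K n j Y| ≤
        w n * (C * max C' 0 * N * La) * ra ^ (K - n - 1 - j) + θ ^ σ * (C * max C' 0 * N) * r0 ^ (K - n - 1 - j) := by
    intro j hj
    rw [Finset.mem_range] at hj
    rw [levelDataT_succ_sub PT hLM hn hj V (c K n j)]
    refine (Finset.abs_sum_le_sum_abs _ _).trans ?_
    refine (Finset.sum_le_sum fun Y hY => hc K n hn j hj V hV hV₁ hV₂ Y hY).trans ?_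
    -- split the summand into the rate piece (b = a) and the slack piece (b = 0)
    have hsplit : ∀ Y, C * Real.exp (-κ₁ * D.treeLen K (1 + j) Y) * (((F.L : ℝ) ^ (K - n - 1 - j))⁻¹) ^ 4 *
          (w n * (((F.L : ℝ) ^ (1 + j))⁻¹) ^ a + θBal F.L γ b₀ p₀ n ^ σ) =
        w n * (C * Real.exp (-κ₁ * D.treeLen K (1 + j) Y) * (((F.L : ℝ) ^ (K - n - 1 - j))⁻¹) ^ 4 *
            (((F.L : ℝ) ^ (1 + j))⁻¹) ^ a) +
          θ ^ σ * (C * Real.exp (-κ₁ * D.treeLen K (1 + j) Y) * (((F.L : ℝ) ^ (K - n - 1 - j))⁻¹) ^ 4 *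
            (((F.L : ℝ) ^ (1 + j))⁻¹) ^ (0 : ℝ)) := by
      intro Y
      rw [Real.rpow_zero]
      ring
    simp_rw [hsplit]
    rw [Finset.sum_add_distrib, ← Finset.mul_sum, ← Finset.mul_sum]
    have hA := level_budget_geom_le (D := D) hLC hBV hC a hn (D.triv K (K - n)) hj
    have hB := level_budget_geom_le (D := D) hLC hBV hC (0 : ℝ) hn (D.triv K (K - n)) hj
    -- rewrite the two level budgets in the letters of the global row
    have hA' : 8 * C * max C' 0 * (F.L : ℝ) ^ (3 * F.m) * (F.L : ℝ) ^ ((3 * n - a * (K - n : ℕ) : ℝ)) *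
          ((F.L : ℝ) ^ (a - 1)) ^ (K - n - 1 - j) = (C * max C' 0 * N * La) * ra ^ (K - n - 1 - j) := by
      rw [show 8 * C * max C' 0 * (F.L : ℝ) ^ (3 * F.m) * (F.L : ℝ) ^ ((3 * n - a * (K - n : ℕ) : ℝ)) =
          C * max C' 0 * (8 * (F.L : ℝ) ^ (3 * F.m) * (F.L : ℝ) ^ ((3 * n - a * (K - n : ℕ) : ℝ))) by ring,
        eight_pow_eq_card_mul F a K n]
      ring
    have hB' : 8 * C * max C' 0 * (F.L : ℝ) ^ (3 * F.m) * (F.L : ℝ) ^ ((3 * n - (0 : ℝ) * (K - n : ℕ) : ℝ)) *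
          ((F.L : ℝ) ^ ((0 : ℝ) - 1)) ^ (K - n - 1 - j) = (C * max C' 0 * N) * r0 ^ (K - n - 1 - j) := by
      rw [show 8 * C * max C' 0 * (F.L : ℝ) ^ (3 * F.m) * (F.L : ℝ) ^ ((3 * n - (0 : ℝ) * (K - n : ℕ) : ℝ)) =
          C * max C' 0 * (8 * (F.L : ℝ) ^ (3 * F.m) * (F.L : ℝ) ^ ((3 * n - (0 : ℝ) * (K - n : ℕ) : ℝ))) by ring,
        eight_pow_eq_card_mul F 0 K n, Real.rpow_zero, zero_sub, Real.rpow_neg_one]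
      ring
    rw [hA'] at hA
    rw [hB'] at hB
    refine (add_le_add (mul_le_mul_of_nonneg_left hA hwn) (mul_le_mul_of_nonneg_left hB hθσ)).trans_eq ?_
    ring
  -- (4) sum over the levels: geometric series in both pieces
  have hsumA : ∑ j ∈ Finset.range (K - n), ra ^ (K - n - 1 - j) ≤ 1 / (1 - ra) := sum_reflect_geom_le hra0 hra1 (K - n)
  have hsum0 : ∑ j ∈ Finset.range (K - n), r0 ^ (K - n - 1 - j) ≤ 1 / (1 - r0) := sum_reflect_geom_le hr00 hr01 (K - n)
  have hmatched : |∑ j ∈ Finset.range (K - n), (levelDataT D PT (K + 1) (j + 1) n V - levelDataT D PT K j n V -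
          ∑ Y ∈ D.Loc K (K - n) (D.triv K (K - n)) (1 + j), c K n j Y)| ≤
      w n * (C * max C' 0 * N * La) * (1 / (1 - ra)) + θ ^ σ * (C * max C' 0 * N) * (1 / (1 - r0)) := by
    refine (Finset.abs_sum_le_sum_abs _ _).trans ((Finset.sum_le_sum hlevel).trans ?_)
    rw [Finset.sum_add_distrib, ← Finset.mul_sum, ← Finset.mul_sum]
    have hcA : 0 ≤ w n * (C * max C' 0 * N * La) := mul_nonneg hwn (by positivity)
    have hc0 : 0 ≤ θ ^ σ * (C * max C' 0 * N) := mul_nonneg hθσ (by positivity)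
    exact add_le_add (mul_le_mul_of_nonneg_left hsumA hcA) (mul_le_mul_of_nonneg_left hsum0 hc0)
  -- (5) assemble
  refine (abs_add_le _ _).trans ((add_le_add hextra hmatched).trans ?_)
  have hkey : max C' 0 * C_T * N * (w n * La) + (w n * (C * max C' 0 * N * La) * (1 / (1 - ra)) +
        θ ^ σ * (C * max C' 0 * N) * (1 / (1 - r0))) =
      max C' 0 * N * ((C_T + C / (1 - ra)) * (w n * La) + (C / (1 - r0)) * θ ^ σ) := by
    ring
  rw [hkey]
  have hT1 : C_T + C / (1 - ra) ≤ C_T + C / (1 - ra) + C / (1 - r0) := le_add_of_nonneg_right hT0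
  have hT2 : C / (1 - r0) ≤ C_T + C / (1 - ra) + C / (1 - r0) := by linarith
  have hin : (C_T + C / (1 - ra)) * (w n * La) + (C / (1 - r0)) * θ ^ σ ≤
      (C_T + C / (1 - ra) + C / (1 - r0)) * (w n * La + θ ^ σ) := by
    rw [mul_add]
    exact add_le_add (mul_le_mul_of_nonneg_right hT1 (mul_nonneg hwn hLa0)) (mul_le_mul_of_nonneg_right hT2 hθσ)
  calc max C' 0 * N * ((C_T + C / (1 - ra)) * (w n * La) + (C / (1 - r0)) * θ ^ σ)
      ≤ max C' 0 * N * ((C_T + C / (1 - ra) + C / (1 - r0)) * (w n * La + θ ^ σ)) :=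
        mul_le_mul_of_nonneg_left hin (mul_nonneg hC' hN0)
    _ = _ := by ring

/-- The constant of the local→global producer is nonnegative (`0 < a < 1`, `0 ≤ C`, `0 ≤ C_T`). [folklore] -/
theorem producerConst_nonneg (F : T3Family) {a C C_T C' : ℝ} (ha1 : a < 1) (hC : 0 ≤ C) (hCT : 0 ≤ C_T) :
    0 ≤ max C' 0 * (C_T + C / (1 - (F.L : ℝ) ^ (a - 1)) + C / (1 - (F.L : ℝ)⁻¹)) := by
  have hL : (1 : ℝ) < (F.L : ℝ) := by exact_mod_cast F.hL.2
  have hra1 : (F.L : ℝ) ^ (a - 1) < 1 := Real.rpow_lt_one_of_one_lt_of_neg hL (by linarith)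
  have hr01 : (F.L : ℝ)⁻¹ < 1 := inv_lt_one_of_one_lt₀ hL
  exact mul_nonneg (le_max_right _ _)
    (add_nonneg (add_nonneg hCT (div_nonneg hC (by linarith))) (div_nonneg hC (by linarith)))

/-! ## §2 The six chart rows (three on `S`) give the global slack row on `S` -/

/-- **THE CHART ROWS ON `S` GIVE THE GLOBAL SLACK ROW ON `S`, RATE WEIGHT `θ(n)²`, `σ = 7`** — the composition of §2 and §3 for `0 < γ ≤ 1`, `√γ ≤ e^{1−p₀}`, `0 < b₀`,
`0 ≤ p₀`, `0 < a < 1`, nonnegative constants, the window `(C_s + C_B)·θ(n) ≤ 1`, the five producer rows (full window) and the six chart rows (the three configuration rows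
ON `S`): `GlobalSupRateWSlackOn S D b₀ p₀ (θ²) a 7 C₀` with the EXPLICIT `K`-uniform constant
`C₀ = max(C′,0)·(C_T + C₁/(1 − L^{a−1}) + C₁/(1 − L⁻¹))`, `C₁ = 5(C_s²C + 6C_sC_BC_E) + 2C_R` (the constant does not read `S`).
[cite: King1986, Thm 3.4 (3.9) p.656, Prop. 3.6 p.662; Balaban1985UV3, (43)-(46) pp.266-267, (47) p.267, (57) p.270] -/
theorem globalSupRateWSlackOn_of_charts {𝕍 : Type} [NormedAddCommGroup 𝕍] [NormedSpace ℂ 𝕍] (S : WinPred F)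
    {D : AlphaDataT3 F γ} {PT : TermFn F} {Φ : ChartFam 𝕍 F} {e : VacFam F} {B : CfgFam 𝕍 F} {R : RemFam F}
    {b₀ p₀ κ a C C_E C_R C_s C_B C_T C' : ℝ}
    (hγ : 0 < γ) (hγ1 : γ ≤ 1) (hγe : Real.sqrt γ ≤ Real.exp (1 - p₀)) (hb : 0 < b₀) (hp : 0 ≤ p₀) (ha : 0 < a) (ha1 : a < 1)
    (hC : 0 ≤ C) (hCE : 0 ≤ C_E) (hCR : 0 ≤ C_R) (hCs : 0 ≤ C_s) (hCB : 0 ≤ C_B) (hCT : 0 ≤ C_T)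
    (hθ1 : ∀ n, (C_s + C_B) * θBal F.L γ b₀ p₀ n ≤ 1)
    (hdec : PintDecompTrivT D PT) (hLC : LocCover D κ C') (hBV : LocBlockVolume D) (hLM : LocMatched D) (hTS : TermSizeTrivT D PT b₀ p₀ C_T κ)
    (hT : TaylorSplitΦ PT Φ e B R) (hK : FlatKernelCauchyΦ D Φ κ a C) (hE : KernelSizeΦ D Φ κ C_E)
    (hR : RemainderSmallΦOn S D R b₀ p₀ κ C_R) (hS : CfgSizeΦOn S D B b₀ p₀ C_s) (hBC : CfgCauchyΦOn S D B b₀ p₀ a C_B fun _ => 1) :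
    GlobalSupRateWSlackOn S D b₀ p₀ (fun n => θBal F.L γ b₀ p₀ n ^ 2) a 7
      (max C' 0 * (C_T + (5 * (C_s ^ 2 * C + 6 * C_s * C_B * C_E) + 2 * C_R) / (1 - (F.L : ℝ) ^ (a - 1)) +
        (5 * (C_s ^ 2 * C + 6 * C_s * C_B * C_E) + 2 * C_R) / (1 - (F.L : ℝ)⁻¹))) := by
  have hLn : 1 ≤ F.L := F.hL.2.le
  have hL1 : (1 : ℝ) ≤ (F.L : ℝ) := by exact_mod_cast hLn
  have hθ0 : ∀ n, 0 ≤ θBal F.L γ b₀ p₀ n := fun n => (T3MinimiserStabilityReduction.θBal_pos hLn hγ hγ1 hb p₀ n).le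
  have hPC := polymerCauchyMinAtTSlackOn_of_charts S hC hCE hCR hCs hCB hL1 hθ0 hθ1 hT hK hE hR hS hBC
  exact globalSupRateWSlackOn_of_polymerWSlackOn S (w := fun n => θBal F.L γ b₀ p₀ n ^ 2) hγ hγ1 hb (fun n => pow_nonneg (hθ0 n) 2)
    (fun n => pow_le_pow_left₀ (hθ0 (n + 1)) (θBal_succ_le hLn hγ hγ1 hγe hb.le hp n) 2) ha ha1 (by positivity) hCT hdec hLC hBV hLM hTS hPC

end LocalToGlobal
end Summit.QuantumFields.YangMills.Theorems.GlobalSlackLocalToGlobalOn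

end
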